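import Literature.MathematicalPhysics.QuantumFieldTheory.BalabanImbrieJaffe1984to88.BIJ88LocDerivHolder231RegularRegion

/-!
# `BalabanImbrieJaffe1984to88.BIJ88LocDerivHolder231RegularTorus` — T. Bałaban, J. Imbrie, A. Jaffe, *Effective action and cluster properties
of the abelian Higgs model*, Commun. Math. Phys. **114** (1988) 257–315 [BalabanImbrieJaffe1988], Sect. 2 p. 263 [PDF 7], (2.27)–(2.29), (2.31)
and the sentence after (2.33): **THE HÖLDER MEMBER OF TOP ORDER `1 + θ` (`0 ≤ θ < 1`) OF (2.31) WITH `Ω = T_η` AT A (2.23)-REGULAR NON-FLAT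
BACKGROUND `u = e^{ieεA}`, FOR THE PRINTED LOCALIZATION DATA WITH BIG-BLOCK CUBES** (r18 gen 24's `BIJ88Close231RegularTorusCwt`: the big-block
hulls `cubeFamB` of p29 gen 26's torus cubes, the weights `λ_α` of (2.27)) **AND A CUT-OFF SMOOTH IN THE LATTICE POINT** (r18's product form
`ζ^Π(R₁, R₀)`; print: *"ζ_k(x₁, x₂) is a smooth function of x₁ − x₂"*): the gauge-covariant Hölder quotient
`(L^k/|x₁ − x₂|_T)^θ·|U(A(Γ_{x₁x₂}))(D_uψ)(x₂, μ) − (D_uψ)(x₁, μ)|` of the COVARIANT DERIVATIVE of the DIFFERENCE `ψ = G_{k,loc}(u)f − G_k(T_η,u)f`,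
the transport `U(A(Γ)) = e^{ieεA(Γ)}` taken along a nearest-neighbour contour `Γ` AT THE NON-FLAT FIELD ([6] p. 573: *"Γ_{x,x′} a shortest
contour"*), obeys `(L^kε)·c₀·(1 + L^k((R₀−R₁)⁻¹ + s_g⁻¹))²·[m·e^{−δ₀(2R−1)/L^k} + e^{−(δ₀/2)(R₁−1)/L^k}]·e^{−(δ₀/2)D/L^k}‖f‖_∞` — the (2.31) twin of
this seat's `BIJ88LocDerivHolder230RegularTorus` ((2.30), p353266), on the regular-background lineage (value / kernel / covariant-derivative
members `opClose231_regular_torus_cwt` / `deriv231_regular_torus_cwt` of gen 23/24; p29's Hölder `θ ≤ 1` member `BIJ88LocHolder231RegularTorus`).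
With it every member of the p. 263 sentence *"covariant derivatives and Hölder derivatives of G_{k,loc}(u) of order less than two"* for (2.31),
`Ω = T_η`, is in the tree at the (2.23)-regular background.

statement-level skeleton of published theorems with citation tags; proofs where landed; nothing here is a claim about the Yang–Mills mass gap

PDF held: `paper:balaban1988-cmp114-bij-abelian-higgs-effective-action` (journal page = PDF page + 256); p. 263 [PDF 7] re-read this session on the
materialised text layer (`lit read … --pages 4-9`); [6] = T. Bałaban, *Regularity and decay of lattice Green's functions*, Commun. Math. Phys. **89**
(1983) 571–597 [Balaban1983RegularityDecay], (1.9) p. 573 and the `δG` clause (1.11)–(1.12) p. 573 through r01's `BIJ85NeumannPropagatorRegularHolder`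
(`input19_holder_regular_deep`, `holder_covD_gBox_sub_gBox_univ_le`) and `BIJ85NeumannPropagatorRegularDeriv` (`input110_deriv_regular_univ`,
`input112_deriv_regular_deep`).

CITATION HEADER (lean-in-tree rule).  lit-balaban cell (HOME `run/shared/lean/pub/lit-balaban/`), Phase 2, seat r18 gen 25 (unit `lit-balaban-r18`,
literature-prover-lit-balaban-r18-g25-0; C2 §§1–4 fold owner), free-target protocol G.5-34(d), TAKING line HOME/STATUS.md 2026-08-23T05:32:05Z
(window → 05:52Z, no objection; cc p29 g30 — his `BIJ88LocHolder231RegularTorus` is the order-`θ ≤ 1` member, other order — and r01 g35), the next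
item after (γ′) of the owner's `HOME/lit-balaban-r18/C2S14-CLOSURE.md` v1.16v §5.  Rows of `HOME/lit-balaban-r18/ROWS-C2.md` served (LOCATED
MEMBERS, cells only; heads unchanged): **C2.Eq2.31** p. 263 (head p02's `BIJ88OpClose231Proof`), **C2.Claim@263** (head = p08's abstract hence-step
`BIJ88HolderDecay230`).  Kind: theorems only (no definition, no `Prop`-valued fact).  Files USED BY NAME, nothing restated: (v1.2) r18 g25 `BIJ88Close231RegularRegionCwt` (**`deriv231_regular_region_of_lipschitz`**) and `BIJ88LocDerivHolder231RegularRegion` (**`derivHolder231_regular_region_of_smooth`**); r18 g25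
`BIJ88LocDerivHolder230RegularTorus` (§1 kernel **`norm_holA_mul_sub_le`**, `T_le_length_of_isSChain`; p353266 — imported), r01 g26
`BIJ85NeumannPropagatorRegularHolder` (`IsSChain`, `SNbr`, `bondSum`, `holA`, `holA_nil`, `holA_cons`, `norm_holA`, **`input19_holder_regular_deep`**,
**`holder_covD_gBox_sub_gBox_univ_le`** = [6] (1.9) and its (1.11)–(1.12) clause at regular `A` for big-block regions; p348815), r01 g26
`BIJ85NeumannPropagatorRegularDeriv` (**`input110_deriv_regular_univ`**, **`input112_deriv_regular_deep`**; p347438), r18 g24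
`BIJ88Close231RegularTorusCwt` (`bbHull`, `bbHull_bigBlock`, `cubeFamB`, `deepRows`, `mem_deepRows`, `rowMargin`, `rowHyp_ii_hull`,
**`inputs_regular`**; p347978–p350995), p29 g28/29 `BIJ88LocDerivHolder230FlatTorus` (**`abs_weight_shift_sub_le_of_hull`**,
**`abs_weight_bondDiff_sub_le_of_hull`**), `BIJ88LocHolder230FlatTorus` (**`norm_sub_le_mul_l1_of_bond_bound`**), `BIJ88LocDeriv231FlatTorus`
(**`covD_gLocT_sub_apply`** = the (2.32) bond identity with `G₀` subtracted in the cube part), `BIJ88LocDeriv230FlatTorus` (`T_shift_le_one`,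
`abs_T_shift_sub_le`), `BIJ88LocDeriv230ZetaPiFlatTorus` (`norm_rowSource_sub_le_of_lipschitz`, `zetaPi_zero_eq_zero_of_le`, `zetaPi_zero_eq_one_of_le`,
`abs_zetaPi_zero_le_one`, `abs_zetaPi_zero_shift_sub_le`, `abs_zetaPi_zero_secondDiff_le`), r18 g20 `BIJ88HkLocHolderTorus` (`zetaPi`,
`secondDiffConst`), p31 (`gBox`, `gLocT`, `cubeT`, `cubePt`, `boxCoord`, `cubePt_boxCoord`, `cubePt_add_single`, `norm_rowSource_le`, `rowSource_ne_zero`,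
`abs_lam_le_one`), p29 g26 `BIJ88LocWeights227Torus` (`labels`, `lamFam`, `lamT`, `activeLabels`, `rowHyp_i`, `mem_activeLabels_of_ne_zero_of_deep`,
`card_subtype_activeLabels_le`, `mem_and_abs_sub_le_of_T_le`, `sum_abs_lamT_le_one`), r01's dictionary `BIJ85CovariantHiggsDictionary.expGauge`,
b04 `B4GaugeCovariance.pathEnd`, p38's metric `B5Ineq137Torus.T` (+ `B3Bound323ZeroTorus.T_eq_supDist`), r18's `BIJ88Sect3Statements.covD`/`cfg`/`toC`,
`Literature.Analysis.Calculus.exists_abs_deriv_and_deriv_deriv_smoothTransition_le`.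

THE PRINTED TEXT (verbatim, p. 263).  *"|(G_{k,loc}(u)f − G_k(Ω,u)f)(x)| ≦ e^{−cr(e_k)}e^{−c dist(suppt f,x)}‖f‖_∞, (2.31) for dist(x, Ω^c) ≧
O(r(e_k)). [Each G_k(□_α, u) is close to G_k(Ω, u) for the relevant x₁, x₂, therefore the convex combination and G_{k,loc} are close also.] …
for (2.31) we assume smoothness throughout the subset Ω ⊂ T_η … Bounds analogous to (2.30), (2.31) hold for covariant derivatives and Holder
derivatives of G_{k,loc}(u) of order less than two."*  [6] p. 573: *"|x − x′|^{−α}|U(A(Γ_{x,x′}))(D^η_{A,μ}G_k(Ω, A)f)(x′) − (D^η_{A,μ}G_k(Ω, A)f)(x)| ≦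
c₀exp(−δ₀ dist({x, x′}, supp f))‖f‖_∞ (1.9) … If Ω ⊂ Ω₀, then for δG_k(Ω,Ω₀,A) defined by the equality δG_k(Ω,Ω₀,A) = G_k(Ω,A) − G_k(Ω₀,A), (1.11)
we have the inequalities … (with the same restrictions on x, x′) with the additional factor (1.12) on the right hand sides."* — the displayed
factor (1.12), in the audited transcription of record (r01's `BIJ85NeumannPropagatorRegularHolder.holder_covD_gBox_sub_gBox_le`, via
[Balaban1984PropagatorsI] Prop. 2.1 (2.26)), reads `exp(−δ₀ dist(supp f, Ω^c) − δ₀ dist({x, x′}, Ω^c))` (v1.1, ref-5 gen 68 D-g68-1: v1 printed a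
paraphrase of this factor inside the quotation marks; the Lean statements take r01's declarations BY NAME and were never affected).  *"Smooth"* `u`
is taken in the (2.23)-regular form of [BalabanImbrieJaffe1985] p. 326 / [6]: `u = e^{ieεA}` with
`L^kε|e|/e_k·|∂A| ≦ c·e_k^{β−1}/L^k` on the whole torus, `0 < e_k ≦ e₁` (r18 gen 24's HONEST SCOPE (ii), inherited).

WHAT IS PROVED (theorems only; 0 `sorry`; standard axioms).
* §1 KERNEL — the tail sources for a GENERIC cut-off (`|ζ″| ≤ 1`, `ζ″ = 1` within `R₁`): `norm_tail_le'` (`|(ζ″ − 1)f| ≤ 2‖f‖_∞`),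
  `norm_tailDiff_le'`, `T_gt_of_tail_ne_zero'` / `T_gt_of_tailDiff_ne_zero'` (the tail sources of the bond `⟨x, x+e_μ⟩` live at `|x − y|_T > R₁ − 1`).
* §2 **`deriv231_regular_of_lipschitz`** — the covariant-derivative analogue of (2.31), `Ω = T_η`, at the regular `u` for the data with a GENERIC
  Lipschitz cut-off (one-step modulus `K₁/(R₀−R₁)`): r18 gen 24's `deriv231_regular_torus_cwt` (p13's cut-off of record) VERBATIM with the cut-off
  abstracted — the far-pair input of §5 and the order-`1` member for `ζ^Π` (§6).
* §3 **`input112_holder_regular_univ`** — r01's `holder_covD_gBox_sub_gBox_univ_le` (the Hölder member of [6]'s `δG` clause (1.11)–(1.12) at the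
  regular `u`, `Ω₀ = T^{(0)}`) read in p38's metric `T` and level-`k` units, exactly as r01's own §5 reads (1.9) (`input19_holder_regular_deep`).
* §4 KERNEL — first and mixed second differences of a cut-off between two chart points along the coordinate hull (p29's
  `norm_sub_le_mul_l1_of_bond_bound`): **`abs_zeta_shift_sub_le_of_hull`** (`|ζ″(x(z₂)+e_μ,y) − ζ″(x(z₁)+e_μ,y)| ≤ K₁|z₂ − z₁|₁`),
  **`abs_zeta_bondDiff_sub_le_of_hull`** (`|Δ_μζ″(x(z₂),y) − Δ_μζ″(x(z₁),y)| ≤ K₂|z₂ − z₁|₁`).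
* §5 **`derivHolder231_regular_of_smooth`** — `∃ s₀ ∀ s ≥ s₀ ∃ c₀ e₁ > 0` (from `(d, L, a, e, c, β, θ, K₁, K₂, s)` only) such that on every torus
  of the series (`P.d = d+1`, `P.L = L ≥ 2`), at every level `1 ≤ k ≤ K` with `k + s ≤ m + K`, `3L^kL^s ≤ |T^{(0)}|`, for every `A` (2.23)-regular on
  `T^{(0)}` (`0 < e_k ≤ e₁`), every reference no-wrap box `Ω₀ = c·L^k + Π_i[0, L^kM₀_i)` shorter than the torus with torus gap `≥ R`, grid spacing
  `s_g ≥ 1`, half-width `W ≥ 2s_g/3 + R₀/2 + R`, radii `R > rowMargin + (d+2)L^k + 1`, `0 ≤ R₁ < R₀`, EVERY real cut-off `ζ″` with `|ζ″| ≤ 1`,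
  `ζ″(x,y) = 0` for `|x − y|_T ≥ R₀`, `ζ″(x,y) = 1` for `|x − y|_T ≤ R₁`, first lattice differences in `x` `≤ K₁/(R₀−R₁)` and mixed second ones
  `≤ K₂/(R₀−R₁)²`, every direction `μ`, all bonds `⟨x₁,x₁+e_μ⟩`, `⟨x₂,x₂+e_μ⟩` with their four end points in `Ω₀` at chart depth `≥ R₀ + R`, every
  nearest-neighbour contour `Γ = (x₁, l)` (r01's `IsSChain`) ending at `x₂` with `|Γ| ≤ (d+1)|x₁ − x₂|_T`, and every `f` (`‖f‖_∞ ≤ F`) supported at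
  sup-torus distance `≥ D ≥ 0` from `x₁` and `x₂`:
  `(L^k/|x₁−x₂|_T)^θ·‖U(A(Γ))(D_uψ)(x₂,μ) − (D_uψ)(x₁,μ)‖ ≤ (L^kε)·c₀·(1 + L^k((R₀−R₁)⁻¹ + s_g⁻¹))²·[m·e^{−δ₀(2R−1)/L^k} + e^{−(δ₀/2)(R₁−1)/L^k}]·e^{−(δ₀/2)D/L^k}·F`,
  `ψ = G_{k,loc}(u)f − G_k(T_η,u)f` (written as the difference of the two covariant derivatives), `δ₀ = 1/(8L^s)`,
  `m = (⌊(L^k − 1 + R₀)/s_g⌋ + 3)^{d+1}`, `U(A(Γ)) = holA e A x₁ l`.  MECHANISM (near pairs `|x₁ − x₂|_T ≤ L^k`): the (2.32) bond identity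
  `covD_gLocT_sub_apply` at both bonds with `G_k(□̃_α,u) − G_k(T_η,u)` in the cube part, and EIGHT terms — CUBE PART (sources in `supp f`,
  `T_η ∖ □̃_α` at distance `≥ R − 1 − (d+2)L^k` from every row used and `≥ R` from the active sources, whence the factor `e^{−δ₀(2R−1)/L^k}`):
  (A) the Hölder member of (1.11)–(1.12) per hull active at `x₂+e_μ` (§3), rows `x₁`, `x₂`; (B) the derivative member of (1.11)–(1.12)
  (`input112_deriv_regular_deep`) at `⟨x₁,x₁+e_μ⟩` on the difference of the row sources of `x₂+e_μ`, `x₁+e_μ` (Lipschitz along the chart hull,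
  `abs_weight_shift_sub_le_of_hull`); (C) the transported difference of the VALUES of `(G_k(□̃_α,u) − G_k(T_η,u))` on the bond-difference source of
  `x₂`, telescoped ALONG `Γ` AT THE NON-FLAT `u` (`norm_holA_mul_sub_le`) with (B)'s input per bond at the contour sites — all `rowMargin`-deep in
  the active hulls because they lie within `(d+2)|x₁−x₂|_T + 1 ≤ (d+2)L^k + 1` of the active point (whence the margin in `R`); (D) the VALUE
  member of (1.11)–(1.12) (`inputs_regular`, third member) on the SECOND difference of the row weights (`abs_weight_bondDiff_sub_le_of_hull`) —
  TAIL PART (`G_k(T_η,u)` on `(ζ″ − 1)f` and its differences, which live at torus distance `> R₁ − 1` from `x₁` or `x₂`, hence at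
  `≥ max(D − (d+1)L^k, R₁ − 1 − (d+2)L^k, 0)` from every row used, whence `e^{−(δ₀/2)(R₁−1)/L^k}·e^{−(δ₀/2)D/L^k}`): (A″) [6] (1.9) on the whole
  torus (`input19_holder_regular_deep`, `X = T^{(0)}`) on `(ζ″(x₂+e_μ,·) − 1)f`; (B″) (1.10)'s derivative member on the whole torus
  (`input110_deriv_regular_univ`) at `⟨x₁,x₁+e_μ⟩` on `(ζ″(x₂+e_μ,·) − ζ″(x₁+e_μ,·))f` (§4, `≤ K₁(d+1)|x₁−x₂|_T/(R₀−R₁)·F`); (C″) the telescoping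
  along `Γ` of `G_k(T_η,u)(Δ_μζ″(x₂,·)f)` with (B″)'s input per bond; (D″) (1.10)'s value member on the whole torus (`inputs_regular`, first
  member) on the second difference `(Δ_μζ″(x₂,·) − Δ_μζ″(x₁,·))f` (§4, `≤ K₂(d+1)|x₁−x₂|_T/(R₀−R₁)²·F`); far pairs: two order-`1` members (§2),
  `|U(A(Γ))| = 1`; coincident points: `|Γ| ≤ 0` forces `Γ = ∅`, `U = 1`.
* §6 **`derivHolder231_regular_zetaPi`** — §5 for `ζ″ = ζ^Π(R₁, R₀)` (`1 ≤ R₁ < R₀ ≤ (|T^{(0)}| − 3)/2`), constants from `(d, L, a, e, c, β, θ, s)`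
  and the tree's universal bound `C_σ` on `|σ′|`, `|σ″|`; **`deriv231_regular_zetaPi`** — the order-`1` member (§2) for `ζ^Π`.
HONEST SCOPE / DIVERGENCE.  (i) `u` is EXACTLY `e^{ieεA}` with `A` (2.23)-regular ON THE WHOLE TORUS (r18 gen 24's HONEST SCOPE (ii); `Ω = T_η`
only — print's general `Ω ⊂ T_η` with *"smoothness throughout the subset Ω"* is r18 g25's `BIJ88Close231RegularRegionCwt` /
`BIJ88LocDerivHolder231RegularRegion` (SINCE v1.2 THIS FILE'S §2 AND §5 ARE THEIR CASE `Ω = T^{(0)}`); no change of gauge; bondwise/plaquette-small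
`u` beyond the regular class waits for p30's (β′) `δG` input).  (ii) THE CUBES ARE r18's BIG-BLOCK HULLS `cubeFamB` (r18's divergence (iv));
`G_{k,loc}(u)` is the (2.28) object of THAT family; deep bonds only (chart depth `≥ R₀ + R`, `R > rowMargin + (d+2)L^k + 1 = O(L^kL^s)` — print's
*"O(r(e_k))"* margin in `L^k`-units once `L^s ≲ r(e_k)`); the bracket `[m·e^{−δ₀(2R−1)/L^k} + e^{−(δ₀/2)(R₁−1)/L^k}]` is print's `e^{−cr(e_k)}` at the
printed radii `R, R₁ ~ r(e_k)L^k`, `s_g, R₀ − R₁ ≫ L^k` (gen 24's §6 bracket with the square of `(1 + L^k((R₀−R₁)⁻¹ + s_g⁻¹))`).  (iii) The cut-off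
must be C^{1,1} IN THE LATTICE POINT (second differences `O((R₀−R₁)⁻²)`): p13's cut-off of record is only Lipschitz in `x` and is covered by §2
(order `1`) but NOT by §5; r18's `ζ^Π` is (§6) — both satisfy the printed (2.29).  (iv) The transport is [6]'s `U(A(Γ))` along ANY
nearest-neighbour contour of length `≤ (d+1)|x₁ − x₂|_T` in r01's list vocabulary (`IsSChain`/`pathEnd`/`holA`) — the vocabulary of the (1.9)/(1.12)
inputs; p29's `θ ≤ 1` members use T4's `chainHol` (r01's `BIJ85ContourTransportDictionary` interconverts; not needed here).  (v) Constants: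
`s₀, c₀, e₁` existential (six providers' thresholds), `δ₀ = 1/(8L^s)` explicit (r01's `1/(4L^s)` weakened, halved on the tail part as in gen 24's
§6); the geometric losses at the contour sites are absorbed in the factor `e^{(d+2)δ₀}` of `c₀`; no non-vacuity instance (hypotheses = those of
`derivHolder230_regular_of_smooth` plus `ζ″ = 1` within `R₁`, met by `ζ^Π`; the region file's `opClose231_regular_region_cwt_nonvacuous` covers the
value member).  (vi) VERSIONS: v1 (p355410) carried the direct four-term (§2) and eight-term (§5) proofs with `Ω = T^{(0)}`; v1.1 (p358139) =
ref-5 D-g68-1 docfix; **v1.2 = §2 and §5 re-proved as the case `Ω = T^{(0)}` of r18 g25's region files** (`deriv231_regular_region_of_lipschitz`,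
`derivHolder231_regular_region_of_smooth` — the same proofs VERBATIM with `T^{(0)} ↦ Ω`, landed as p356334 / p357888), ALL STATEMENTS OF THIS FILE
BYTE-IDENTICAL to v1/v1.1 (the duplicated 1500 proof lines leave the tree; the dependency now runs region ⟶ whole torus).  Import: r18 g25
`BIJ88LocDerivHolder231RegularRegion` (→ `BIJ88Close231RegularRegionCwt`, `BIJ88LocDerivHolder230RegularTorus` → r18 g24 `BIJ88Close231RegularTorusCwt`,
p29 g28 `BIJ88LocDerivHolder230FlatTorus`, r01 g26 `BIJ85NeumannPropagatorRegularHolder`).  Literature + Mathlib only.  Unit `lit-balaban-r18`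
(literature-prover-lit-balaban-r18-g25-0), 2026-08-23.  NOT summit progress.
-/

open scoped BigOperators Matrix ComplexConjugate
open Finset Matrix

namespace Literature.MathematicalPhysics.QuantumFieldTheory.BalabanImbrieJaffe1984to88.BIJ88LocDerivHolder231RegularTorus

open Literature.MathematicalPhysics.QuantumFieldTheory.Balaban1983to89
open BIJ88Sect3Statements (U1 toC cfg covD norm_toC)
open BIJ85BlockAveragesTorus BIJ85BlockAveragesTorusK
open BIJ88NeumannPropagator227Torus (gBox)
open BIJ88DeltaLoc234Torus (gLocT)
open BIJ88NeumannPropagatorFlatDecayCube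
open BIJ88LocWeights227Torus
open BIJ85CovariantHiggsDictionary (expGauge toC_expGauge)
open BIJ85NeumannPropagatorRegularHolder (SNbr IsSChain bondSum holA holA_nil holA_cons norm_holA input19_holder_regular_deep
  holder_covD_gBox_sub_gBox_univ_le)
open BIJ88LocDeriv230FlatTorus (T_shift_le_one abs_T_shift_sub_le)
open B4GaugeCovariance (pathEnd)
open BIJ88Close231RegularTorusCwt (bbHull bbHull_bigBlock cubeFamB deepRows mem_deepRows rowMargin rowHyp_ii_hull inputs_regular)
open BIJ88Close231RegularRegionCwt (deriv231_regular_region_of_lipschitz)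
open BIJ88LocDerivHolder231RegularRegion (derivHolder231_regular_region_of_smooth)

noncomputable section

variable {d : ℕ} {P : Params}

/-! ## §1 Kernel: the (2.29) tails for a generic cut-off (`|ζ″| ≤ 1`, `ζ″ = 1` within `R₁`, one-step modulus in the output point) -/

section Tails

/-- kernel: **the tail source** `((ζ″(x′,y) − 1)f(y)` is bounded by `2‖f‖_∞` when `|ζ″| ≤ 1`. [cite: BalabanImbrieJaffe1988, (2.29) p.263] -/
theorem norm_tail_le' {ζ : Balaban1983to89.Site P 0 → Balaban1983to89.Site P 0 → ℝ} (hζabs : ∀ x y, |ζ x y| ≤ 1)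
    (x : Balaban1983to89.Site P 0) {f : Balaban1983to89.Site P 0 → ℂ} {F : ℝ} (hF : ∀ y, ‖f y‖ ≤ F) (y : Balaban1983to89.Site P 0) :
    ‖((ζ x y : ℂ) - 1) * f y‖ ≤ 2 * F := by
  have hF0 : 0 ≤ F := (norm_nonneg _).trans (hF y)
  have hz1 : ‖(ζ x y : ℂ) - 1‖ ≤ 2 := by
    rw [← Complex.ofReal_one, ← Complex.ofReal_sub, Complex.norm_real, Real.norm_eq_abs, abs_le]
    have h := abs_le.1 (hζabs x y)
    constructor <;> linarith [h.1, h.2]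
  calc ‖((ζ x y : ℂ) - 1) * f y‖ = ‖(ζ x y : ℂ) - 1‖ * ‖f y‖ := norm_mul _ _
    _ ≤ 2 * F := mul_le_mul hz1 (hF y) (norm_nonneg _) (by norm_num)

/-- kernel: **the tail-difference source** `(ζ″(x+e_μ,y) − ζ″(x,y))f(y)` is bounded by the one-step modulus times `‖f‖_∞`.
[cite: BalabanImbrieJaffe1988, (2.29) p.263] -/
theorem norm_tailDiff_le' {ζ : Balaban1983to89.Site P 0 → Balaban1983to89.Site P 0 → ℝ} {Kζ : ℝ} (hKζ : 0 ≤ Kζ)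
    {x : Balaban1983to89.Site P 0} {μ : Fin P.d} (hζlip : ∀ y, |ζ (x.shift μ) y - ζ x y| ≤ Kζ)
    {f : Balaban1983to89.Site P 0 → ℂ} {F : ℝ} (hF : ∀ y, ‖f y‖ ≤ F) (y : Balaban1983to89.Site P 0) :
    ‖((ζ (x.shift μ) y : ℂ) - (ζ x y : ℂ)) * f y‖ ≤ Kζ * F := by
  have hz : ‖(ζ (x.shift μ) y : ℂ) - (ζ x y : ℂ)‖ ≤ Kζ := by
    rw [← Complex.ofReal_sub, Complex.norm_real, Real.norm_eq_abs]; exact hζlip y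
  calc ‖((ζ (x.shift μ) y : ℂ) - (ζ x y : ℂ)) * f y‖ = ‖(ζ (x.shift μ) y : ℂ) - (ζ x y : ℂ)‖ * ‖f y‖ := norm_mul _ _
    _ ≤ Kζ * F := mul_le_mul hz (hF y) (norm_nonneg _) hKζ

/-- kernel: **where the tail source of the bond `⟨x, x+e_μ⟩` does not vanish, `f ≠ 0` and `|x − y|_T > R₁ − 1`** (`ζ″ = 1` within `R₁`, one
lattice step). [cite: BalabanImbrieJaffe1988, (2.29) p.263] -/
theorem T_gt_of_tail_ne_zero' {ζ : Balaban1983to89.Site P 0 → Balaban1983to89.Site P 0 → ℝ} {R₁ : ℝ}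
    (hζR₁ : ∀ x y, B5Ineq137Torus.T P 0 x y ≤ R₁ → ζ x y = 1) (x : Balaban1983to89.Site P 0) (μ : Fin P.d)
    {f : Balaban1983to89.Site P 0 → ℂ} {y : Balaban1983to89.Site P 0} (hne : ((ζ (x.shift μ) y : ℂ) - 1) * f y ≠ 0) :
    f y ≠ 0 ∧ R₁ - 1 < B5Ineq137Torus.T P 0 x y := by
  refine ⟨right_ne_zero_of_mul hne, ?_⟩
  have hz : ζ (x.shift μ) y ≠ 1 := by
    intro h1; exact hne (by rw [h1]; push_cast; ring)
  have hgt : R₁ < B5Ineq137Torus.T P 0 (x.shift μ) y := lt_of_not_ge fun hle => hz (hζR₁ (x.shift μ) y hle)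
  have h1 := abs_le.1 (abs_T_shift_sub_le x y μ)
  linarith

/-- kernel: **where the tail-difference source does not vanish, `f ≠ 0` and `|x − y|_T > R₁ − 1`**. [cite: BalabanImbrieJaffe1988, (2.29) p.263] -/
theorem T_gt_of_tailDiff_ne_zero' {ζ : Balaban1983to89.Site P 0 → Balaban1983to89.Site P 0 → ℝ} {R₁ : ℝ}
    (hζR₁ : ∀ x y, B5Ineq137Torus.T P 0 x y ≤ R₁ → ζ x y = 1) (x : Balaban1983to89.Site P 0) (μ : Fin P.d)
    {f : Balaban1983to89.Site P 0 → ℂ} {y : Balaban1983to89.Site P 0}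
    (hne : ((ζ (x.shift μ) y : ℂ) - (ζ x y : ℂ)) * f y ≠ 0) :
    f y ≠ 0 ∧ R₁ - 1 < B5Ineq137Torus.T P 0 x y := by
  refine ⟨right_ne_zero_of_mul hne, ?_⟩
  by_contra hle
  push Not at hle
  have h1 := abs_le.1 (abs_T_shift_sub_le x y μ)
  have hx : ζ x y = 1 := hζR₁ x y (by linarith)
  have hx' : ζ (x.shift μ) y = 1 := hζR₁ (x.shift μ) y (by linarith)
  exact hne (by rw [hx, hx']; push_cast; ring)

end Tails

/-! ## §2 The covariant-derivative analogue of (2.31), `Ω = T_η`, at a (2.23)-regular background for a GENERIC Lipschitz cut-off (far pairs) -/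

section DerivLipschitz

/-- **THE COVARIANT-DERIVATIVE ANALOGUE OF (2.31) WITH `Ω = T_η` AT A (2.23)-REGULAR NON-FLAT BACKGROUND `u = e^{ieεA}`, FOR THE PRINTED
LOCALIZATION DATA WITH BIG-BLOCK CUBES AND A GENERIC LIPSCHITZ CUT-OFF** (p. 263: *"Bounds analogous to (2.30), (2.31) hold for covariant
derivatives … of G_{k,loc}(u) of order less than two"*; the cut-off `ζ″` of (2.29) enters only through `|ζ″| ≤ 1`, `ζ″ = 0` beyond `R₀`,
`ζ″ = 1` within `R₁` and a one-step modulus `K₁/(R₀ − R₁)` in the output point — r18 gen 24's `BIJ88Close231RegularTorusCwt.deriv231_regular_torus_cwt`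
(p13's cut-off of record) VERBATIM with the cut-off abstracted (this file's §1 tails, p29's `norm_rowSource_sub_le_of_lipschitz`)).
`∃ s₀ ∀ s ≥ s₀ ∃ c₀ e₁ > 0` (from `(d, L, a, e, c, β, K₁, s)`) such that on every torus of the series, at every level `1 ≤ k ≤ K`, `k + s ≤ m + K`,
`3L^kL^s ≤ |T^{(0)}|`, for every `A` (2.23)-regular on `T^{(0)}` (`0 < e_k ≤ e₁`), every reference box `Ω₀` (torus gap `≥ R`), grid spacing
`s_g ≥ 1`, half-width `W ≥ 2s_g/3 + R₀/2 + R`, radii `R > rowMargin + 1`, `0 ≤ R₁ < R₀`, every such cut-off, every bond `⟨x, x+e_μ⟩` with both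
endpoints in `Ω₀` at chart depth `≥ R₀ + R`, and every `f` with `‖f‖_∞ ≤ F` supported at sup-torus distance `≥ D ≥ 0` from `x`:
`‖D_u(G_{k,loc}(u)f)(⟨x,μ⟩) − D_u(G_k(T_η,u)f)(⟨x,μ⟩)‖ ≤`
`(L^kε)·c₀·[m(1 + L^k((R₀−R₁)⁻¹ + s_g⁻¹))e^{−δ₀(2R−1)/L^k} + (1 + L^k(R₀−R₁)⁻¹)e^{−(δ₀/2)(R₁−1)/L^k}]·e^{−(δ₀/2)D/L^k}·F`, `δ₀ = 1/(8L^s)`,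
`m = (⌊(L^k−1+R₀)/s_g⌋+3)^{d+1}`. [cite: BalabanImbrieJaffe1988, (2.31) p.263] -/
theorem deriv231_regular_of_lipschitz (d L : ℕ) (hL : 2 ≤ L) {a : ℝ} (ha : 0 < a) (e creg β : ℝ) (hcreg : 0 ≤ creg) (hβ : 0 < β)
    {K₁ : ℝ} (hK₁ : 0 ≤ K₁) :
    ∃ s₀ : ℕ, ∀ s : ℕ, s₀ ≤ s → ∃ c₀ e₁ : ℝ, 0 < c₀ ∧ 0 < e₁ ∧
      ∀ (P : Params) (hPd : P.d = d + 1), P.L = L → ∀ (k : ℕ), 1 ≤ k → k ≤ P.K → k + s ≤ P.m + P.K →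
      3 * (L ^ k * L ^ s) ≤ P.sitesPerDir 0 →
      ∀ (A : PBond P 0 → ℝ) (ec : ℝ), 0 < ec → ec ≤ e₁ →
      (∀ (z : Balaban1983to89.Site P 0) (μ ν : Fin P.d),
          P.spacing k * |e| / ec * |A ⟨z.shift μ, ν⟩ - A ⟨z, ν⟩| ≤ creg * ec ^ (β - 1) / (L : ℝ) ^ k) →
      ∀ (c M0 : Fin (d + 1) → ℕ), (∀ i, c i * P.L ^ k + P.L ^ k * M0 i ≤ P.sitesPerDir 0) → (∀ i, P.L ^ k * M0 i < P.sitesPerDir 0) →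
      ∀ (sg W : ℕ), 1 ≤ sg → ∀ (R R₀ R₁ : ℝ), ((rowMargin L (d + 1) k s : ℕ) : ℝ) + 1 < R → 0 ≤ R₁ → R₁ < R₀ →
        2 * (sg : ℝ) / 3 + R₀ / 2 + R ≤ W → (∀ i, ((P.L ^ k * M0 i : ℕ) : ℝ) + R ≤ P.sitesPerDir 0) →
      ∀ (ζ : Balaban1983to89.Site P 0 → Balaban1983to89.Site P 0 → ℝ), (∀ x y, |ζ x y| ≤ 1) →
        (∀ x y, R₀ ≤ B5Ineq137Torus.T P 0 x y → ζ x y = 0) → (∀ x y, B5Ineq137Torus.T P 0 x y ≤ R₁ → ζ x y = 1) →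
        (∀ (x y : Balaban1983to89.Site P 0) (ν : Fin P.d), |ζ (x.shift ν) y - ζ x y| ≤ K₁ / (R₀ - R₁)) →
      ∀ (x : Balaban1983to89.Site P 0) (μ : Fin P.d),
        x ∈ (cubeT hPd (P.L ^ k) c fun i => P.L ^ k * M0 i) →
        (∀ i, R₀ + R ≤ (boxCoord hPd (P.L ^ k) c x i : ℝ) ∧ (boxCoord hPd (P.L ^ k) c x i : ℝ) + (R₀ + R) ≤ (P.L ^ k * M0 i : ℕ) - 1) →
        x.shift μ ∈ (cubeT hPd (P.L ^ k) c fun i => P.L ^ k * M0 i) →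
        (∀ i, R₀ + R ≤ (boxCoord hPd (P.L ^ k) c (x.shift μ) i : ℝ) ∧
          (boxCoord hPd (P.L ^ k) c (x.shift μ) i : ℝ) + (R₀ + R) ≤ (P.L ^ k * M0 i : ℕ) - 1) →
      ∀ (f : Balaban1983to89.Site P 0 → ℂ) (F D : ℝ), (∀ y, ‖f y‖ ≤ F) → 0 ≤ D → (∀ y, f y ≠ 0 → D ≤ B5Ineq137Torus.T P 0 x y) →
        ‖covD P.eps⁻¹ (cfg (expGauge P e A))
              (gLocT (B1RG242Torus.α P a k * (P.L : ℝ) ^ (k * P.d)) P.eps⁻¹ (expGauge P e A) k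
                (cubeFamB hPd (P.L ^ k) c M0 sg W (L ^ k * L ^ s)) (lamFam hPd (P.L ^ k) c M0 sg)
                ζ *ᵥ f) ⟨x, μ⟩ -
            covD P.eps⁻¹ (cfg (expGauge P e A))
              (gBox (B1RG242Torus.α P a k * (P.L : ℝ) ^ (k * P.d)) P.eps⁻¹ (expGauge P e A) k univ *ᵥ f) ⟨x, μ⟩‖ ≤
          P.spacing k * (c₀ * ((((⌊(((P.L : ℝ) ^ k) - 1 + R₀) / sg⌋₊ : ℝ) + 3) ^ (d + 1)) *
                (1 + (P.L : ℝ) ^ k * ((R₀ - R₁)⁻¹ + (sg : ℝ)⁻¹)) *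
                Real.exp (-(1 / (8 * (L : ℝ) ^ s) * (((P.L : ℝ) ^ k)⁻¹ * (2 * R - 1)))) +
              (1 + (P.L : ℝ) ^ k * (R₀ - R₁)⁻¹) * Real.exp (-(1 / (8 * (L : ℝ) ^ s) / 2 * (((P.L : ℝ) ^ k)⁻¹ * (R₁ - 1))))) *
            Real.exp (-(1 / (8 * (L : ℝ) ^ s) / 2 * (((P.L : ℝ) ^ k)⁻¹ * D))) * F) := by
  -- v1.2: the case `Ω = T^{(0)}` of r18 gen 25's `BIJ88Close231RegularRegionCwt.deriv231_regular_region_of_lipschitz` (v1/v1.1 carried the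
  -- direct four-term proof, now the region file's §4 verbatim with `T^{(0)} ↦ Ω`)
  obtain ⟨s₀, H⟩ := deriv231_regular_region_of_lipschitz d L hL ha e creg β hcreg hβ hK₁
  refine ⟨s₀, fun s hs => ?_⟩
  obtain ⟨c₀, e₁, hc₀, he₁, G⟩ := H s hs
  refine ⟨c₀, e₁, hc₀, he₁, ?_⟩
  intro P hPd hPL k hk1 hkK hks hsize A ec hec hece hreg c M0 hfit0 hN0 sg W hsg R R₀ R₁ hRm hR₁ hR10 hW hgap ζ hζabs hζ0 hζR₁ hζ1
    x μ hx hdeep hxe hdeepe f F D hF hD hsupp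
  exact G P hPd hPL k hk1 hkK hks hsize univ (fun z z' _ => by simp) A ec hec hece (fun z _ μ' ν => hreg z μ' ν) c M0 hfit0 hN0
    (subset_univ _) sg W hsg R R₀ R₁ hRm hR₁ hR10 hW hgap ζ hζabs hζ0 hζR₁ hζ1 x μ hx hdeep hxe hdeepe f F D hF hD hsupp

end DerivLipschitz

/-! ## §3 The Hölder member of the `δG` clause (1.11)–(1.12) at a regular `u`, `Ω₀ = T_η`, in the level-`k` input shape -/

section HolderInput

/-- kernel: the units identity `e^{−E/(cL^sL^k)} = e^{−(1/(cL^s))·((L^k)⁻¹E)}`. [folklore] -/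
private theorem exp_units (c Ls Lk E : ℝ) (hc : c ≠ 0) (hLs : Ls ≠ 0) (hLk : Lk ≠ 0) :
    Real.exp (-(E / (c * Ls * Lk))) = Real.exp (-(1 / (c * Ls) * (Lk⁻¹ * E))) := by
  congr 1
  field_simp

/-- **THE (1.11)–(1.12) HÖLDER INPUT SHAPE AT A REGULAR `u = e^{ieεA}`, `Ω ⊆ Ω₀ = T^{(0)}`** (r01's `holder_covD_gBox_sub_gBox_univ_le` =
[7] Theorem p. 573, the Hölder member *"with the additional factor (1.12)"*, read in p38's metric `T` and level-`k` units exactly as r01's §5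
reads (1.9)): `∃ s₀, ∀ α ∈ [0,1), ∀ s ≥ s₀, ∃ c₀ e₁ > 0`: on every `Setup` torus, `1 ≤ k ≤ K`, `k + s ≤ m + K`, `3L^kL^s ≤ |T^{(0)}|`, for every
big-block union `X`, `A` regular on `T^{(0)}` (`0 < e_k ≤ e₁`), rows `x₁ ≠ x₂` both `R₀′`-deep in `X`, a nearest-neighbour contour `Γ` from `x₁`
to `x₂` of length `≤ d·T(x₁,x₂)`, `f` with `‖f‖ ≤ F` supported in `X` at distance `≥ D` from both rows, `T∖X` at distance `≥ D_b` from both rows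
and `≥ D_f` from `supp f`:
`(L^k/T(x₁,x₂))^α·‖U(A(Γ))·D_u((G_k(X,u) − G_k(T,u))f)(x₂,μ) − D_u((G_k(X,u) − G_k(T,u))f)(x₁,μ)‖ ≤ s_k·c₀·e^{−δ₀(L^k)⁻¹D}·e^{−δ₀(L^k)⁻¹(D_b+D_f)}·F`,
`δ₀ = 1/(8L^s)`. [cite: Balaban1983RegularityDecay, Theorem p.573 (1.9), (1.11)–(1.12)]
[cite: BalabanImbrieJaffe1985, p.326 «also satisfy the regularity and decay estimates of [7]»] -/
theorem input112_holder_regular_univ (d L : ℕ) (hd : 1 ≤ d) (hL : 2 ≤ L) {a : ℝ} (ha : 0 < a) (e creg β : ℝ) (hcreg : 0 ≤ creg)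
    (hβ : 0 < β) :
    ∃ s₀ : ℕ, ∀ {α : ℝ}, 0 ≤ α → α < 1 → ∀ s : ℕ, s₀ ≤ s → ∃ c₀ e₁ : ℝ, 0 < c₀ ∧ 0 < e₁ ∧
      ∀ (P : Params), P.d = d → P.L = L → ∀ {k : ℕ}, 1 ≤ k → k ≤ P.K → k + s ≤ P.m + P.K →
      3 * (L ^ k * L ^ s) ≤ P.sitesPerDir 0 →
      ∀ (X : Finset (Balaban1983to89.Site P 0)),
        (∀ z z' : Balaban1983to89.Site P 0,
          (∀ μ, (z μ).val / (L ^ k * L ^ s) = (z' μ).val / (L ^ k * L ^ s)) → (z ∈ X ↔ z' ∈ X)) →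
      ∀ (A : PBond P 0 → ℝ) {ec : ℝ}, 0 < ec → ec ≤ e₁ →
      (∀ (z : Balaban1983to89.Site P 0) (μ ν : Fin P.d),
          P.spacing k * |e| / ec * |A ⟨z.shift μ, ν⟩ - A ⟨z, ν⟩| ≤ creg * ec ^ (β - 1) / (L : ℝ) ^ k) →
      ∀ (μ : Fin P.d) (x₁ x₂ : Balaban1983to89.Site P 0), x₂ ≠ x₁ →
        (∀ y, B5Ineq137Torus.T P 0 x₁ y
          ≤ (2 * (5 * (L ^ k * L ^ s) / 8 + L ^ k) + 2 * (L ^ k * L ^ s) * (d + 1) + 1 : ℕ) → y ∈ X) →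
        (∀ y, B5Ineq137Torus.T P 0 x₂ y
          ≤ (2 * (5 * (L ^ k * L ^ s) / 8 + L ^ k) + 2 * (L ^ k * L ^ s) * (d + 1) + 1 : ℕ) → y ∈ X) →
      ∀ (l : List (Balaban1983to89.Site P 0)), IsSChain x₁ l → pathEnd x₁ l = x₂ →
        (l.length : ℝ) ≤ (d : ℝ) * B5Ineq137Torus.T P 0 x₁ x₂ →
      ∀ (f : Balaban1983to89.Site P 0 → ℂ) (F D Db Df : ℝ), (∀ y, ‖f y‖ ≤ F) → (∀ y, y ∉ X → f y = 0) →
        (∀ y, f y ≠ 0 → D ≤ B5Ineq137Torus.T P 0 x₁ y) → (∀ y, f y ≠ 0 → D ≤ B5Ineq137Torus.T P 0 x₂ y) →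
        (∀ w, w ∉ X → Db ≤ B5Ineq137Torus.T P 0 x₁ w) → (∀ w, w ∉ X → Db ≤ B5Ineq137Torus.T P 0 x₂ w) →
        (∀ y, f y ≠ 0 → ∀ w, w ∉ X → Df ≤ B5Ineq137Torus.T P 0 y w) →
        ((P.L : ℝ) ^ k / B5Ineq137Torus.T P 0 x₁ x₂) ^ α *
            ‖holA e A x₁ l * covD P.eps⁻¹ (cfg (expGauge P e A))
                (gBox (B1RG242Torus.α P a k * (P.L : ℝ) ^ (k * P.d)) P.eps⁻¹ (expGauge P e A) k X *ᵥ f -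
                  gBox (B1RG242Torus.α P a k * (P.L : ℝ) ^ (k * P.d)) P.eps⁻¹ (expGauge P e A) k univ *ᵥ f) ⟨x₂, μ⟩
              - covD P.eps⁻¹ (cfg (expGauge P e A))
                (gBox (B1RG242Torus.α P a k * (P.L : ℝ) ^ (k * P.d)) P.eps⁻¹ (expGauge P e A) k X *ᵥ f -
                  gBox (B1RG242Torus.α P a k * (P.L : ℝ) ^ (k * P.d)) P.eps⁻¹ (expGauge P e A) k univ *ᵥ f) ⟨x₁, μ⟩‖
          ≤ P.spacing k * (c₀ * Real.exp (-(1 / (8 * (L : ℝ) ^ s) * (((P.L : ℝ) ^ k)⁻¹ * D))) *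
              Real.exp (-(1 / (8 * (L : ℝ) ^ s) * (((P.L : ℝ) ^ k)⁻¹ * (Db + Df)))) * F) := by
  obtain ⟨s₀, hs₀⟩ := holder_covD_gBox_sub_gBox_univ_le d L hd hL ha e creg β hcreg hβ
  refine ⟨s₀, fun {α} hα0 hα1 s hs => ?_⟩
  obtain ⟨c₀, e₁, hc₀, he₁, hmain⟩ := hs₀ hα0 hα1 s hs
  refine ⟨c₀, e₁, hc₀, he₁, ?_⟩
  intro P hPd hPL k hk1 hkK hks hsize X hbig A ec hec hece hreg μ x₁ x₂ hne hint₁ hint₂ l hch hend hlen f F D Db Df hF hfX hsD₁ hsD₂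
    hDb₁ hDb₂ hDf
  have hF0 : 0 ≤ F := (norm_nonneg _).trans (hF x₁)
  have hLr : (0 : ℝ) < L := by exact_mod_cast (show 0 < L by omega)
  have hLs : (0 : ℝ) < (L : ℝ) ^ s := pow_pos hLr s
  have hLk : (0 : ℝ) < (L : ℝ) ^ k := pow_pos hLr k
  have hsk : 0 < P.spacing k := P.spacing_pos k
  have h := hmain P hPd hPL hk1 hkK hks hsize X hbig A hec hece hreg μ x₁ x₂ hne
    (fun y hy => hint₁ y (by
      rw [B3Bound323ZeroTorus.T_eq_supDist]
      exact_mod_cast hy))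
    (fun y hy => hint₂ y (by
      rw [B3Bound323ZeroTorus.T_eq_supDist]
      exact_mod_cast hy))
    l hch hend (by rw [← B3Bound323ZeroTorus.T_eq_supDist]; exact hlen)
    f F (max D 0) (max Db 0) (max Df 0) hF hfX (le_max_right _ _) (le_max_right _ _) (le_max_right _ _)
    (fun z hz => by
      rw [← B3Bound323ZeroTorus.T_eq_supDist]
      exact max_le (hsD₁ z hz) (B5Ineq137Torus.T_nonneg P 0 x₁ z))
    (fun z hz => by
      rw [← B3Bound323ZeroTorus.T_eq_supDist]
      exact max_le (hsD₂ z hz) (B5Ineq137Torus.T_nonneg P 0 x₂ z))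
    (fun z hz => by
      rw [← B3Bound323ZeroTorus.T_eq_supDist]
      exact max_le (hDb₁ z hz) (B5Ineq137Torus.T_nonneg P 0 x₁ z))
    (fun z hz => by
      rw [← B3Bound323ZeroTorus.T_eq_supDist]
      exact max_le (hDb₂ z hz) (B5Ineq137Torus.T_nonneg P 0 x₂ z))
    (fun y z hy hz => by
      rw [← B3Bound323ZeroTorus.T_eq_supDist, B5Ineq137Torus.T_symm]
      exact max_le (hDf y hy z hz) (B5Ineq137Torus.T_nonneg P 0 y z))
  have hPLk : ((L : ℝ) ^ k)⁻¹ = ((P.L : ℝ) ^ k)⁻¹ := by rw [hPL]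
  have hPk : (0 : ℝ) < (P.L : ℝ) ^ k := pow_pos P.cast_L_pos k
  have hquot : (((LatticeFieldCalculus.supDist x₁ x₂ : ℝ) / (L : ℝ) ^ k)⁻¹) ^ α
      = ((P.L : ℝ) ^ k / B5Ineq137Torus.T P 0 x₁ x₂) ^ α := by
    rw [inv_div, B3Bound323ZeroTorus.T_eq_supDist, hPL]
  rw [exp_units 8 ((L : ℝ) ^ s) ((L : ℝ) ^ k) (max D 0 + max Db 0 + max Df 0) (by norm_num) hLs.ne' hLk.ne', hPLk, hquot] at h
  have hδ : (0 : ℝ) ≤ 1 / (8 * (L : ℝ) ^ s) := by positivity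
  calc _ ≤ c₀ * P.spacing k
        * Real.exp (-(1 / (8 * (L : ℝ) ^ s) * (((P.L : ℝ) ^ k)⁻¹ * (max D 0 + max Db 0 + max Df 0)))) * F := h
    _ ≤ c₀ * P.spacing k * (Real.exp (-(1 / (8 * (L : ℝ) ^ s) * (((P.L : ℝ) ^ k)⁻¹ * D)))
          * Real.exp (-(1 / (8 * (L : ℝ) ^ s) * (((P.L : ℝ) ^ k)⁻¹ * (Db + Df))))) * F := by
        refine mul_le_mul_of_nonneg_right (mul_le_mul_of_nonneg_left ?_ (by positivity)) hF0
        rw [← Real.exp_add]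
        refine Real.exp_le_exp.2 ?_
        have hLki : (0 : ℝ) ≤ ((P.L : ℝ) ^ k)⁻¹ := (inv_pos.2 hPk).le
        have h1 : D + (Db + Df) ≤ max D 0 + max Db 0 + max Df 0 := by
          linarith [le_max_left D 0, le_max_left Db 0, le_max_left Df 0]
        nlinarith [mul_le_mul_of_nonneg_left (mul_le_mul_of_nonneg_left h1 hLki) hδ]
    _ = _ := by ring

end HolderInput

/-! ## §4 Kernel: first and second differences of a smooth cut-off between two chart points, along the coordinate hull -/

section ZetaHull

open BIJ88LocHolder230FlatTorus (norm_sub_le_mul_l1_of_bond_bound)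

variable (hPd : P.d = d + 1) {n : ℕ} {c : Fin (d + 1) → ℕ}

/-- kernel: the two unit steps commute. [folklore] -/
private theorem shift_shift_comm (x : Balaban1983to89.Site P 0) (μ ν : Fin P.d) : (x.shift μ).shift ν = (x.shift ν).shift μ := by
  funext κ
  by_cases h1 : κ = ν
  · subst h1
    by_cases h2 : κ = μ
    · subst h2; rfl
    · simp [Balaban1983to89.Site.shift, Function.update_of_ne h2]
  · by_cases h2 : κ = μ
    · subst h2
      simp [Balaban1983to89.Site.shift, Function.update_of_ne h1]
    · simp [Balaban1983to89.Site.shift, Function.update_of_ne h1, Function.update_of_ne h2]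

/-- **THE CUT-OFF AT TWO SHIFTED CHART POINTS DIFFERS BY AT MOST `K₁·|z₂ − z₁|₁`** (telescoping the one-step modulus along a staircase in the
coordinate hull, p29's `norm_sub_le_mul_l1_of_bond_bound`): `|ζ″(x(z₂)+e_μ, y) − ζ″(x(z₁)+e_μ, y)| ≤ K₁·Σ_j|z₂,j − z₁,j|`.
[cite: BalabanImbrieJaffe1988, (2.29) p.263] -/
theorem abs_zeta_shift_sub_le_of_hull {ζ : Balaban1983to89.Site P 0 → Balaban1983to89.Site P 0 → ℝ} {K₁ : ℝ}
    (hζ1 : ∀ (x y : Balaban1983to89.Site P 0) (ν : Fin P.d), |ζ (x.shift ν) y - ζ x y| ≤ K₁) (z₁ z₂ : Fin (d + 1) → ℤ) (μ : Fin P.d)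
    (y : Balaban1983to89.Site P 0) :
    |ζ ((cubePt hPd n c z₂).shift μ) y - ζ ((cubePt hPd n c z₁).shift μ) y| ≤ K₁ * ∑ j, ((|z₂ j - z₁ j| : ℤ) : ℝ) := by
  set Ψ : (Fin (d + 1) → ℤ) → ℝ := fun z => ζ ((cubePt hPd n c z).shift μ) y with hΨdef
  rw [← Real.norm_eq_abs]
  show ‖Ψ z₂ - Ψ z₁‖ ≤ _
  refine norm_sub_le_mul_l1_of_bond_bound (fun j => min (z₁ j) (z₂ j)) (fun j => max (z₁ j) (z₂ j)) Ψ ?_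
    (fun j => ⟨min_le_left _ _, le_max_left _ _⟩) (fun j => ⟨min_le_right _ _, le_max_right _ _⟩)
  intro z i _ _
  simp only [hΨdef]
  rw [cubePt_add_single, shift_shift_comm, Real.norm_eq_abs]
  exact hζ1 _ y _

/-- **THE BOND DIFFERENCES `Δ_μζ″(·, y)` OF THE CUT-OFF AT TWO CHART POINTS DIFFER BY AT MOST `K₂·|z₂ − z₁|₁`** (telescoping the mixed second
differences): `|(ζ″(x(z₂)+e_μ, y) − ζ″(x(z₂), y)) − (ζ″(x(z₁)+e_μ, y) − ζ″(x(z₁), y))| ≤ K₂·Σ_j|z₂,j − z₁,j|`.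
[cite: BalabanImbrieJaffe1988, (2.29) p.263] -/
theorem abs_zeta_bondDiff_sub_le_of_hull {ζ : Balaban1983to89.Site P 0 → Balaban1983to89.Site P 0 → ℝ} {K₂ : ℝ}
    (hζ2 : ∀ (x y : Balaban1983to89.Site P 0) (κ ν : Fin P.d), |ζ ((x.shift ν).shift κ) y - ζ (x.shift ν) y - ζ (x.shift κ) y + ζ x y| ≤ K₂)
    (z₁ z₂ : Fin (d + 1) → ℤ) (μ : Fin P.d) (y : Balaban1983to89.Site P 0) :
    |(ζ ((cubePt hPd n c z₂).shift μ) y - ζ (cubePt hPd n c z₂) y) - (ζ ((cubePt hPd n c z₁).shift μ) y - ζ (cubePt hPd n c z₁) y)| ≤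
      K₂ * ∑ j, ((|z₂ j - z₁ j| : ℤ) : ℝ) := by
  set Ψ : (Fin (d + 1) → ℤ) → ℝ := fun z => ζ ((cubePt hPd n c z).shift μ) y - ζ (cubePt hPd n c z) y with hΨdef
  rw [← Real.norm_eq_abs]
  show ‖Ψ z₂ - Ψ z₁‖ ≤ _
  refine norm_sub_le_mul_l1_of_bond_bound (fun j => min (z₁ j) (z₂ j)) (fun j => max (z₁ j) (z₂ j)) Ψ ?_
    (fun j => ⟨min_le_left _ _, le_max_left _ _⟩) (fun j => ⟨min_le_right _ _, le_max_right _ _⟩)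
  intro z i _ _
  simp only [hΨdef]
  rw [cubePt_add_single, Real.norm_eq_abs]
  have e : ζ (((cubePt hPd n c z).shift (Fin.cast hPd.symm i)).shift μ) y - ζ ((cubePt hPd n c z).shift (Fin.cast hPd.symm i)) y -
      (ζ ((cubePt hPd n c z).shift μ) y - ζ (cubePt hPd n c z) y) =
      ζ (((cubePt hPd n c z).shift (Fin.cast hPd.symm i)).shift μ) y - ζ ((cubePt hPd n c z).shift (Fin.cast hPd.symm i)) y -
        ζ ((cubePt hPd n c z).shift μ) y + ζ (cubePt hPd n c z) y := by ring
  rw [e]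
  exact hζ2 (cubePt hPd n c z) y μ (Fin.cast hPd.symm i)

end ZetaHull

/-! ## §5 The Hölder member of order `1 + θ` of (2.31), `Ω = T_η`, at a (2.23)-regular background (near pairs: eight-term split) -/

section DerivHolder

/-- **THE HÖLDER MEMBER OF ORDER `1 + θ` (`0 ≤ θ < 1`) OF (2.31) WITH `Ω = T_η` AT A (2.23)-REGULAR NON-FLAT BACKGROUND `u = e^{ieεA}`, FOR
THE PRINTED LOCALIZATION DATA WITH BIG-BLOCK CUBES AND A SMOOTH CUT-OFF, ALONG ANY NEAREST-NEIGHBOUR CONTOUR OF LENGTH `≤ (d+1)|x₁ − x₂|_T`**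
(p. 263: *"Bounds analogous to (2.30), (2.31) hold for covariant derivatives and Holder derivatives of G_{k,loc}(u) of order less than two"* —
the member of top order of (2.31), i.e. [6] (1.9) *"with the additional factor (1.12)"* for `ψ = G_{k,loc}(u)f − G_k(T_η,u)f`).
For `0 ≤ θ < 1` and moduli `K₁, K₂ ≥ 0`: `∃ s₀ ∀ s ≥ s₀ ∃ c₀ e₁ > 0` (from `(d, L, a, e, c, β, θ, K₁, K₂, s)` only) such that on every torus of
the series (`P.d = d+1`, `P.L = L ≥ 2`), at every level `1 ≤ k ≤ K` with `k + s ≤ m + K`, `3L^kL^s ≤ |T^{(0)}|`, for every `A` (2.23)-regular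
on `T^{(0)}` (`0 < e_k ≤ e₁`), `u = e^{ieεA}`, every reference no-wrap box `Ω₀ = c·L^k + Π_i[0, L^kM₀_i)` shorter than the torus with torus gap
`≥ R`, grid spacing `s_g ≥ 1`, half-width `W ≥ 2s_g/3 + R₀/2 + R`, radii `R > rowMargin + (d+2)L^k + 1`, `0 ≤ R₁ < R₀`, EVERY real cut-off
`ζ″` with `|ζ″| ≤ 1`, `ζ″(x,y) = 0` for `|x − y|_T ≥ R₀`, `ζ″(x,y) = 1` for `|x − y|_T ≤ R₁`, first lattice differences in `x` bounded by
`K₁/(R₀−R₁)` and mixed second ones by `K₂/(R₀−R₁)²`, every direction `μ`, all bonds `⟨x₁, x₁+e_μ⟩`, `⟨x₂, x₂+e_μ⟩` with their four end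
points in `Ω₀` at chart depth `≥ R₀ + R`, every nearest-neighbour contour `Γ = (x₁, l)` ending at `x₂` with `|Γ| ≤ (d+1)|x₁ − x₂|_T`, and
every `f` (`‖f‖_∞ ≤ F`) supported at sup-torus distance `≥ D ≥ 0` from `x₁` and from `x₂`, with `ψ = G_{k,loc}(u)f − G_k(T_η,u)f`:
`(L^k/|x₁ − x₂|_T)^θ·‖U(A(Γ))(D_uψ)(x₂, μ) − (D_uψ)(x₁, μ)‖ ≤`
`(L^kε)·c₀·(1 + L^k((R₀−R₁)⁻¹ + s_g⁻¹))²·[m·e^{−δ₀(2R−1)/L^k} + e^{−(δ₀/2)(R₁−1)/L^k}]·e^{−(δ₀/2)D/L^k}·F`, `δ₀ = 1/(8L^s)`,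
`m = (⌊(L^k − 1 + R₀)/s_g⌋ + 3)^{d+1}` (`D_uψ` written as the difference of the two covariant derivatives).  MECHANISM (near pairs
`|x₁ − x₂|_T ≤ L^k`): p29's (2.32) bond identity `covD_gLocT_sub_apply` at both bonds with `G_k(□̃_α,u) − G_k(T_η,u)` in the cube part, and
EIGHT terms — cube part: (A) the Hölder member of [7] (1.11)–(1.12) at the regular `u` (r01's `holder_covD_gBox_sub_gBox_univ_le`, §3) per
hull active at `x₂ + e_μ`; (B) the derivative member of (1.11)–(1.12) (r01's `input112_deriv_regular_deep`) at `⟨x₁,x₁+e_μ⟩` on the difference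
of the row sources of `x₂ + e_μ`, `x₁ + e_μ`; (C) the transported difference of the values of `(G_k(□̃_α,u) − G_k(T_η,u))` on the
bond-difference source of `x₂`, telescoped ALONG `Γ` at the non-flat `u` (`norm_holA_mul_sub_le`) with (B)'s input per bond; (D) the value
member of (1.11)–(1.12) (r18's `inputs_regular`) on the second difference of the row weights — tail part (`G_k(T_η,u)` on `(ζ″ − 1)f`, which
lives at distance `> R₁ − 1`): (A″) [7] (1.9) on the whole torus (r01's `input19_holder_regular_deep`); (B″) (1.10)'s derivative member on
the whole torus (r01's `input110_deriv_regular_univ`) on `(ζ″(x₂+e_μ,·) − ζ″(x₁+e_μ,·))f` (§4); (C″) the telescoping along `Γ` of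
`G_k(T_η,u)(Δ_μζ″(x₂,·)f)`; (D″) (1.10)'s value member on the second difference of `ζ″` (§4); far pairs: two derivative members (§2).
[cite: BalabanImbrieJaffe1988, (2.31) p.263] [cite: Balaban1983RegularityDecay, (1.9), (1.11)–(1.12) p.573] -/
theorem derivHolder231_regular_of_smooth (d L : ℕ) (hL : 2 ≤ L) {a : ℝ} (ha : 0 < a) (e creg β : ℝ) (hcreg : 0 ≤ creg) (hβ : 0 < β)
    {θ : ℝ} (hθ0 : 0 ≤ θ) (hθ1 : θ < 1) {K₁ K₂ : ℝ} (hK₁ : 0 ≤ K₁) (hK₂ : 0 ≤ K₂) :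
    ∃ s₀ : ℕ, ∀ s : ℕ, s₀ ≤ s → ∃ c₀ e₁ : ℝ, 0 < c₀ ∧ 0 < e₁ ∧
      ∀ (P : Params) (hPd : P.d = d + 1), P.L = L → ∀ (k : ℕ), 1 ≤ k → k ≤ P.K → k + s ≤ P.m + P.K →
      3 * (L ^ k * L ^ s) ≤ P.sitesPerDir 0 →
      ∀ (A : PBond P 0 → ℝ) (ec : ℝ), 0 < ec → ec ≤ e₁ →
      (∀ (z : Balaban1983to89.Site P 0) (μ ν : Fin P.d),
          P.spacing k * |e| / ec * |A ⟨z.shift μ, ν⟩ - A ⟨z, ν⟩| ≤ creg * ec ^ (β - 1) / (L : ℝ) ^ k) →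
      ∀ (c M0 : Fin (d + 1) → ℕ), (∀ i, c i * P.L ^ k + P.L ^ k * M0 i ≤ P.sitesPerDir 0) → (∀ i, P.L ^ k * M0 i < P.sitesPerDir 0) →
      ∀ (sg W : ℕ), 1 ≤ sg → ∀ (R R₀ R₁ : ℝ), ((rowMargin L (d + 1) k s : ℕ) : ℝ) + ((d : ℝ) + 2) * (P.L : ℝ) ^ k + 1 < R → 0 ≤ R₁ → R₁ < R₀ →
        2 * (sg : ℝ) / 3 + R₀ / 2 + R ≤ W → (∀ i, ((P.L ^ k * M0 i : ℕ) : ℝ) + R ≤ P.sitesPerDir 0) →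
      ∀ (ζ : Balaban1983to89.Site P 0 → Balaban1983to89.Site P 0 → ℝ), (∀ x y, |ζ x y| ≤ 1) →
        (∀ x y, R₀ ≤ B5Ineq137Torus.T P 0 x y → ζ x y = 0) → (∀ x y, B5Ineq137Torus.T P 0 x y ≤ R₁ → ζ x y = 1) →
        (∀ (x y : Balaban1983to89.Site P 0) (ν : Fin P.d), |ζ (x.shift ν) y - ζ x y| ≤ K₁ / (R₀ - R₁)) →
        (∀ (x y : Balaban1983to89.Site P 0) (κ ν : Fin P.d),
          |ζ ((x.shift ν).shift κ) y - ζ (x.shift ν) y - ζ (x.shift κ) y + ζ x y| ≤ K₂ / (R₀ - R₁) ^ 2) →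
      ∀ (x₁ x₂ : Balaban1983to89.Site P 0) (μ : Fin P.d),
        x₁ ∈ (cubeT hPd (P.L ^ k) c fun i => P.L ^ k * M0 i) →
        (∀ i, R₀ + R ≤ (boxCoord hPd (P.L ^ k) c x₁ i : ℝ) ∧ (boxCoord hPd (P.L ^ k) c x₁ i : ℝ) + (R₀ + R) ≤ (P.L ^ k * M0 i : ℕ) - 1) →
        x₁.shift μ ∈ (cubeT hPd (P.L ^ k) c fun i => P.L ^ k * M0 i) →
        (∀ i, R₀ + R ≤ (boxCoord hPd (P.L ^ k) c (x₁.shift μ) i : ℝ) ∧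
          (boxCoord hPd (P.L ^ k) c (x₁.shift μ) i : ℝ) + (R₀ + R) ≤ (P.L ^ k * M0 i : ℕ) - 1) →
        x₂ ∈ (cubeT hPd (P.L ^ k) c fun i => P.L ^ k * M0 i) →
        (∀ i, R₀ + R ≤ (boxCoord hPd (P.L ^ k) c x₂ i : ℝ) ∧ (boxCoord hPd (P.L ^ k) c x₂ i : ℝ) + (R₀ + R) ≤ (P.L ^ k * M0 i : ℕ) - 1) →
        x₂.shift μ ∈ (cubeT hPd (P.L ^ k) c fun i => P.L ^ k * M0 i) →
        (∀ i, R₀ + R ≤ (boxCoord hPd (P.L ^ k) c (x₂.shift μ) i : ℝ) ∧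
          (boxCoord hPd (P.L ^ k) c (x₂.shift μ) i : ℝ) + (R₀ + R) ≤ (P.L ^ k * M0 i : ℕ) - 1) →
      ∀ (l : List (Balaban1983to89.Site P 0)), IsSChain x₁ l → pathEnd x₁ l = x₂ →
        (l.length : ℝ) ≤ ((d : ℝ) + 1) * B5Ineq137Torus.T P 0 x₁ x₂ →
      ∀ (f : Balaban1983to89.Site P 0 → ℂ) (F D : ℝ), (∀ y, ‖f y‖ ≤ F) → 0 ≤ D →
        (∀ y, f y ≠ 0 → D ≤ B5Ineq137Torus.T P 0 x₁ y) → (∀ y, f y ≠ 0 → D ≤ B5Ineq137Torus.T P 0 x₂ y) →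
        ((P.L : ℝ) ^ k / B5Ineq137Torus.T P 0 x₁ x₂) ^ θ *
          ‖holA e A x₁ l *
              (covD P.eps⁻¹ (cfg (expGauge P e A))
                  (gLocT (B1RG242Torus.α P a k * (P.L : ℝ) ^ (k * P.d)) P.eps⁻¹ (expGauge P e A) k
                    (cubeFamB hPd (P.L ^ k) c M0 sg W (L ^ k * L ^ s)) (lamFam hPd (P.L ^ k) c M0 sg) ζ *ᵥ f) ⟨x₂, μ⟩ -
                covD P.eps⁻¹ (cfg (expGauge P e A))
                  (gBox (B1RG242Torus.α P a k * (P.L : ℝ) ^ (k * P.d)) P.eps⁻¹ (expGauge P e A) k univ *ᵥ f) ⟨x₂, μ⟩) -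
            (covD P.eps⁻¹ (cfg (expGauge P e A))
                (gLocT (B1RG242Torus.α P a k * (P.L : ℝ) ^ (k * P.d)) P.eps⁻¹ (expGauge P e A) k
                  (cubeFamB hPd (P.L ^ k) c M0 sg W (L ^ k * L ^ s)) (lamFam hPd (P.L ^ k) c M0 sg) ζ *ᵥ f) ⟨x₁, μ⟩ -
              covD P.eps⁻¹ (cfg (expGauge P e A))
                (gBox (B1RG242Torus.α P a k * (P.L : ℝ) ^ (k * P.d)) P.eps⁻¹ (expGauge P e A) k univ *ᵥ f) ⟨x₁, μ⟩)‖ ≤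
          P.spacing k * (c₀ * (1 + (P.L : ℝ) ^ k * ((R₀ - R₁)⁻¹ + (sg : ℝ)⁻¹)) ^ 2 *
            ((((⌊(((P.L : ℝ) ^ k) - 1 + R₀) / sg⌋₊ : ℝ) + 3) ^ (d + 1)) *
                Real.exp (-(1 / (8 * (L : ℝ) ^ s) * (((P.L : ℝ) ^ k)⁻¹ * (2 * R - 1)))) +
              Real.exp (-(1 / (8 * (L : ℝ) ^ s) / 2 * (((P.L : ℝ) ^ k)⁻¹ * (R₁ - 1))))) *
            Real.exp (-(1 / (8 * (L : ℝ) ^ s) / 2 * (((P.L : ℝ) ^ k)⁻¹ * D))) * F) := by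
  -- v1.2: the case `Ω = T^{(0)}` of r18 gen 25's `BIJ88LocDerivHolder231RegularRegion.derivHolder231_regular_region_of_smooth` (v1/v1.1
  -- carried the direct eight-term proof, now that file's §4 verbatim with `T^{(0)} ↦ Ω`; the mechanism described above is unchanged)
  obtain ⟨s₀, H⟩ := derivHolder231_regular_region_of_smooth d L hL ha e creg β hcreg hβ hθ0 hθ1 hK₁ hK₂
  refine ⟨s₀, fun s hs => ?_⟩
  obtain ⟨c₀, e₁, hc₀, he₁, G⟩ := H s hs
  refine ⟨c₀, e₁, hc₀, he₁, ?_⟩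
  intro P hPd hPL k hk1 hkK hks hsize A ec hec hece hreg c M0 hfit0 hN0 sg W hsg R R₀ R₁ hR hR₁ hR10 hW hgap ζ hζabs hζ0 hζR₁ hζ1 hζ2
    x₁ x₂ μ hx₁ hdeep₁ hx₁e hdeep₁e hx₂ hdeep₂ hx₂e hdeep₂e l hch hend hlen f F D hF hD hsupp₁ hsupp₂
  exact G P hPd hPL k hk1 hkK hks hsize univ (fun z z' _ => by simp) A ec hec hece (fun z _ μ' ν => hreg z μ' ν) c M0 hfit0 hN0
    (subset_univ _) sg W hsg R R₀ R₁ hR hR₁ hR10 hW hgap ζ hζabs hζ0 hζR₁ hζ1 hζ2 x₁ x₂ μ hx₁ hdeep₁ hx₁e hdeep₁e hx₂ hdeep₂ hx₂e hdeep₂e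
    l hch hend hlen f F D hF hD hsupp₁ hsupp₂

end DerivHolder

/-! ## §6 The members for the smooth product cut-off `ζ″ = ζ^Π(R₁, R₀)` of (2.29) -/

section ZetaPiMember

open BIJ88LocDeriv230ZetaPiFlatTorus (zetaPi_zero_eq_zero_of_le zetaPi_zero_eq_one_of_le abs_zetaPi_zero_le_one
  abs_zetaPi_zero_shift_sub_le abs_zetaPi_zero_secondDiff_le)
open BIJ88HkLocHolderTorus (zetaPi secondDiffConst)
open BIJ88Close231RegularTorusCwt (cubeFamB rowMargin)
open Literature.Analysis.Calculus (exists_abs_deriv_and_deriv_deriv_smoothTransition_le)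

/-- **THE HÖLDER MEMBER OF ORDER `1 + θ` OF (2.31), `Ω = T_η`, AT A (2.23)-REGULAR `u = e^{ieεA}` FOR `G_{k,loc}(u)` BUILT FROM THE BIG-BLOCK
HULLS, THE WEIGHTS OF (2.27) AND THE SMOOTH PRODUCT CUT-OFF `ζ″ = ζ^Π(R₁, R₀)` OF (2.29)** (print p. 263: *"ζ_k(x₁, x₂) is a smooth function
of x₁ − x₂"*, *"Bounds analogous to (2.30), (2.31) hold for covariant derivatives and Holder derivatives of G_{k,loc}(u) of order less than
two"*): for every `0 ≤ θ < 1`, `∃ s₀ ∀ s ≥ s₀ ∃ c₀ e₁ > 0` (from `(d, L, a, e, c, β, θ, s)` and the tree's universal profile bound `C_σ` on `|σ′|`,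
`|σ″|` only) such that, for all data as in `derivHolder231_regular_of_smooth` with `1 ≤ R₁ < R₀ ≤ (|T^{(0)}| − 3)/2`,
`(L^k/|x₁ − x₂|_T)^θ·‖U(A(Γ))(D_uψ)(x₂, μ) − (D_uψ)(x₁, μ)‖ ≤ (L^kε)·c₀·(1 + L^k((R₀−R₁)⁻¹ + s_g⁻¹))²·[m·e^{−δ₀(2R−1)/L^k} + e^{−(δ₀/2)(R₁−1)/L^k}]·e^{−(δ₀/2)D/L^k}·F`,
`ψ = G_{k,loc}(u)f − G_k(T_η,u)f`, `δ₀ = 1/(8L^s)` — §5 at `K₁ = C_σ`, `K₂ = C_σ² + C_σ`.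
[cite: BalabanImbrieJaffe1988, (2.31) p.263] [cite: Balaban1983RegularityDecay, (1.9), (1.11)–(1.12) p.573] -/
theorem derivHolder231_regular_zetaPi (d L : ℕ) (hL : 2 ≤ L) {a : ℝ} (ha : 0 < a) (e creg β : ℝ) (hcreg : 0 ≤ creg) (hβ : 0 < β)
    {θ : ℝ} (hθ0 : 0 ≤ θ) (hθ1 : θ < 1) :
    ∃ s₀ : ℕ, ∀ s : ℕ, s₀ ≤ s → ∃ c₀ e₁ : ℝ, 0 < c₀ ∧ 0 < e₁ ∧
      ∀ (P : Params) (hPd : P.d = d + 1), P.L = L → ∀ (k : ℕ), 1 ≤ k → k ≤ P.K → k + s ≤ P.m + P.K →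
      3 * (L ^ k * L ^ s) ≤ P.sitesPerDir 0 →
      ∀ (A : PBond P 0 → ℝ) (ec : ℝ), 0 < ec → ec ≤ e₁ →
      (∀ (z : Balaban1983to89.Site P 0) (μ ν : Fin P.d),
          P.spacing k * |e| / ec * |A ⟨z.shift μ, ν⟩ - A ⟨z, ν⟩| ≤ creg * ec ^ (β - 1) / (L : ℝ) ^ k) →
      ∀ (c M0 : Fin (d + 1) → ℕ), (∀ i, c i * P.L ^ k + P.L ^ k * M0 i ≤ P.sitesPerDir 0) → (∀ i, P.L ^ k * M0 i < P.sitesPerDir 0) →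
      ∀ (sg W : ℕ), 1 ≤ sg → ∀ (R R₀ R₁ : ℝ), ((rowMargin L (d + 1) k s : ℕ) : ℝ) + ((d : ℝ) + 2) * (P.L : ℝ) ^ k + 1 < R → 1 ≤ R₁ → R₁ < R₀ →
        R₀ ≤ ((P.sitesPerDir 0 : ℝ) - 3) / 2 →
        2 * (sg : ℝ) / 3 + R₀ / 2 + R ≤ W → (∀ i, ((P.L ^ k * M0 i : ℕ) : ℝ) + R ≤ P.sitesPerDir 0) →
      ∀ (x₁ x₂ : Balaban1983to89.Site P 0) (μ : Fin P.d),
        x₁ ∈ (cubeT hPd (P.L ^ k) c fun i => P.L ^ k * M0 i) →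
        (∀ i, R₀ + R ≤ (boxCoord hPd (P.L ^ k) c x₁ i : ℝ) ∧ (boxCoord hPd (P.L ^ k) c x₁ i : ℝ) + (R₀ + R) ≤ (P.L ^ k * M0 i : ℕ) - 1) →
        x₁.shift μ ∈ (cubeT hPd (P.L ^ k) c fun i => P.L ^ k * M0 i) →
        (∀ i, R₀ + R ≤ (boxCoord hPd (P.L ^ k) c (x₁.shift μ) i : ℝ) ∧
          (boxCoord hPd (P.L ^ k) c (x₁.shift μ) i : ℝ) + (R₀ + R) ≤ (P.L ^ k * M0 i : ℕ) - 1) →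
        x₂ ∈ (cubeT hPd (P.L ^ k) c fun i => P.L ^ k * M0 i) →
        (∀ i, R₀ + R ≤ (boxCoord hPd (P.L ^ k) c x₂ i : ℝ) ∧ (boxCoord hPd (P.L ^ k) c x₂ i : ℝ) + (R₀ + R) ≤ (P.L ^ k * M0 i : ℕ) - 1) →
        x₂.shift μ ∈ (cubeT hPd (P.L ^ k) c fun i => P.L ^ k * M0 i) →
        (∀ i, R₀ + R ≤ (boxCoord hPd (P.L ^ k) c (x₂.shift μ) i : ℝ) ∧
          (boxCoord hPd (P.L ^ k) c (x₂.shift μ) i : ℝ) + (R₀ + R) ≤ (P.L ^ k * M0 i : ℕ) - 1) →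
      ∀ (l : List (Balaban1983to89.Site P 0)), IsSChain x₁ l → pathEnd x₁ l = x₂ →
        (l.length : ℝ) ≤ ((d : ℝ) + 1) * B5Ineq137Torus.T P 0 x₁ x₂ →
      ∀ (f : Balaban1983to89.Site P 0 → ℂ) (F D : ℝ), (∀ y, ‖f y‖ ≤ F) → 0 ≤ D →
        (∀ y, f y ≠ 0 → D ≤ B5Ineq137Torus.T P 0 x₁ y) → (∀ y, f y ≠ 0 → D ≤ B5Ineq137Torus.T P 0 x₂ y) →
        ((P.L : ℝ) ^ k / B5Ineq137Torus.T P 0 x₁ x₂) ^ θ *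
          ‖holA e A x₁ l *
              (covD P.eps⁻¹ (cfg (expGauge P e A))
                  (gLocT (B1RG242Torus.α P a k * (P.L : ℝ) ^ (k * P.d)) P.eps⁻¹ (expGauge P e A) k
                    (cubeFamB hPd (P.L ^ k) c M0 sg W (L ^ k * L ^ s)) (lamFam hPd (P.L ^ k) c M0 sg) (zetaPi R₁ R₀ 0) *ᵥ f) ⟨x₂, μ⟩ -
                covD P.eps⁻¹ (cfg (expGauge P e A))
                  (gBox (B1RG242Torus.α P a k * (P.L : ℝ) ^ (k * P.d)) P.eps⁻¹ (expGauge P e A) k univ *ᵥ f) ⟨x₂, μ⟩) -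
            (covD P.eps⁻¹ (cfg (expGauge P e A))
                (gLocT (B1RG242Torus.α P a k * (P.L : ℝ) ^ (k * P.d)) P.eps⁻¹ (expGauge P e A) k
                  (cubeFamB hPd (P.L ^ k) c M0 sg W (L ^ k * L ^ s)) (lamFam hPd (P.L ^ k) c M0 sg) (zetaPi R₁ R₀ 0) *ᵥ f) ⟨x₁, μ⟩ -
              covD P.eps⁻¹ (cfg (expGauge P e A))
                (gBox (B1RG242Torus.α P a k * (P.L : ℝ) ^ (k * P.d)) P.eps⁻¹ (expGauge P e A) k univ *ᵥ f) ⟨x₁, μ⟩)‖ ≤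
          P.spacing k * (c₀ * (1 + (P.L : ℝ) ^ k * ((R₀ - R₁)⁻¹ + (sg : ℝ)⁻¹)) ^ 2 *
            ((((⌊(((P.L : ℝ) ^ k) - 1 + R₀) / sg⌋₊ : ℝ) + 3) ^ (d + 1)) *
                Real.exp (-(1 / (8 * (L : ℝ) ^ s) * (((P.L : ℝ) ^ k)⁻¹ * (2 * R - 1)))) +
              Real.exp (-(1 / (8 * (L : ℝ) ^ s) / 2 * (((P.L : ℝ) ^ k)⁻¹ * (R₁ - 1))))) *
            Real.exp (-(1 / (8 * (L : ℝ) ^ s) / 2 * (((P.L : ℝ) ^ k)⁻¹ * D))) * F) := by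
  obtain ⟨C, hC0, hC1, hC2⟩ := exists_abs_deriv_and_deriv_deriv_smoothTransition_le
  have hK₂ : 0 ≤ C ^ 2 + C := by positivity
  obtain ⟨s₀, H0⟩ := derivHolder231_regular_of_smooth d L hL ha e creg β hcreg hβ hθ0 hθ1 hC0 hK₂
  refine ⟨s₀, fun s hs => ?_⟩
  obtain ⟨c₀, e₁, hc₀, he₁, H⟩ := H0 s hs
  refine ⟨c₀, e₁, hc₀, he₁, ?_⟩
  intro P hPd hPL k hk1 hkK hks hsize A ec hec hece hreg c M0 hfit0 hN0 sg W hsg R R₀ R₁ hR hR₁ hR10 hR₀N hW hgap x₁ x₂ μ hx₁ hdeep₁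
    hx₁e hdeep₁e hx₂ hdeep₂ hx₂e hdeep₂e l hch hend hlen f F D hF hD hsupp₁ hsupp₂
  have eK : secondDiffConst C R₁ R₀ = (C ^ 2 + C) / (R₀ - R₁) ^ 2 := by rw [secondDiffConst, div_pow, add_div]
  exact H P hPd hPL k hk1 hkK hks hsize A ec hec hece hreg c M0 hfit0 hN0 sg W hsg R R₀ R₁ hR (zero_le_one.trans hR₁) hR10 hW hgap
    (zetaPi R₁ R₀ 0) (abs_zetaPi_zero_le_one R₁ R₀) (zetaPi_zero_eq_zero_of_le hR10) (zetaPi_zero_eq_one_of_le hR10)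
    (abs_zetaPi_zero_shift_sub_le hC1 hR10) (fun x y κ ν => (abs_zetaPi_zero_secondDiff_le hC1 hC2 hR10 hR₁ hR₀N x y κ ν).trans_eq eK)
    x₁ x₂ μ hx₁ hdeep₁ hx₁e hdeep₁e hx₂ hdeep₂ hx₂e hdeep₂e l hch hend hlen f F D hF hD hsupp₁ hsupp₂

/-- **THE COVARIANT-DERIVATIVE ANALOGUE OF (2.31), `Ω = T_η`, AT A (2.23)-REGULAR `u` FOR THE SMOOTH PRODUCT CUT-OFF `ζ″ = ζ^Π(R₁, R₀)`** (the
order-`1` member for the data of this file; §2 at `K₁ = C_σ` — r18 gen 24's `deriv231_regular_torus_cwt` is the same member for p13's cut-off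
of record): `‖D_u(G_{k,loc}(u)f)(⟨x,μ⟩) − D_u(G_k(T_η,u)f)(⟨x,μ⟩)‖ ≤`
`(L^kε)·c₀·[m(1 + L^k((R₀−R₁)⁻¹ + s_g⁻¹))e^{−δ₀(2R−1)/L^k} + (1 + L^k(R₀−R₁)⁻¹)e^{−(δ₀/2)(R₁−1)/L^k}]·e^{−(δ₀/2)D/L^k}·F` for `R > rowMargin + 1`,
`0 ≤ R₁ < R₀`, bond end points at chart depth `≥ R₀ + R`. [cite: BalabanImbrieJaffe1988, (2.31) p.263] -/
theorem deriv231_regular_zetaPi (d L : ℕ) (hL : 2 ≤ L) {a : ℝ} (ha : 0 < a) (e creg β : ℝ) (hcreg : 0 ≤ creg) (hβ : 0 < β) :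
    ∃ s₀ : ℕ, ∀ s : ℕ, s₀ ≤ s → ∃ c₀ e₁ : ℝ, 0 < c₀ ∧ 0 < e₁ ∧
      ∀ (P : Params) (hPd : P.d = d + 1), P.L = L → ∀ (k : ℕ), 1 ≤ k → k ≤ P.K → k + s ≤ P.m + P.K →
      3 * (L ^ k * L ^ s) ≤ P.sitesPerDir 0 →
      ∀ (A : PBond P 0 → ℝ) (ec : ℝ), 0 < ec → ec ≤ e₁ →
      (∀ (z : Balaban1983to89.Site P 0) (μ ν : Fin P.d),
          P.spacing k * |e| / ec * |A ⟨z.shift μ, ν⟩ - A ⟨z, ν⟩| ≤ creg * ec ^ (β - 1) / (L : ℝ) ^ k) →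
      ∀ (c M0 : Fin (d + 1) → ℕ), (∀ i, c i * P.L ^ k + P.L ^ k * M0 i ≤ P.sitesPerDir 0) → (∀ i, P.L ^ k * M0 i < P.sitesPerDir 0) →
      ∀ (sg W : ℕ), 1 ≤ sg → ∀ (R R₀ R₁ : ℝ), ((rowMargin L (d + 1) k s : ℕ) : ℝ) + 1 < R → 0 ≤ R₁ → R₁ < R₀ →
        2 * (sg : ℝ) / 3 + R₀ / 2 + R ≤ W → (∀ i, ((P.L ^ k * M0 i : ℕ) : ℝ) + R ≤ P.sitesPerDir 0) →
      ∀ (x : Balaban1983to89.Site P 0) (μ : Fin P.d),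
        x ∈ (cubeT hPd (P.L ^ k) c fun i => P.L ^ k * M0 i) →
        (∀ i, R₀ + R ≤ (boxCoord hPd (P.L ^ k) c x i : ℝ) ∧ (boxCoord hPd (P.L ^ k) c x i : ℝ) + (R₀ + R) ≤ (P.L ^ k * M0 i : ℕ) - 1) →
        x.shift μ ∈ (cubeT hPd (P.L ^ k) c fun i => P.L ^ k * M0 i) →
        (∀ i, R₀ + R ≤ (boxCoord hPd (P.L ^ k) c (x.shift μ) i : ℝ) ∧
          (boxCoord hPd (P.L ^ k) c (x.shift μ) i : ℝ) + (R₀ + R) ≤ (P.L ^ k * M0 i : ℕ) - 1) →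
      ∀ (f : Balaban1983to89.Site P 0 → ℂ) (F D : ℝ), (∀ y, ‖f y‖ ≤ F) → 0 ≤ D → (∀ y, f y ≠ 0 → D ≤ B5Ineq137Torus.T P 0 x y) →
        ‖covD P.eps⁻¹ (cfg (expGauge P e A))
              (gLocT (B1RG242Torus.α P a k * (P.L : ℝ) ^ (k * P.d)) P.eps⁻¹ (expGauge P e A) k
                (cubeFamB hPd (P.L ^ k) c M0 sg W (L ^ k * L ^ s)) (lamFam hPd (P.L ^ k) c M0 sg)
                (zetaPi R₁ R₀ 0) *ᵥ f) ⟨x, μ⟩ -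
            covD P.eps⁻¹ (cfg (expGauge P e A))
              (gBox (B1RG242Torus.α P a k * (P.L : ℝ) ^ (k * P.d)) P.eps⁻¹ (expGauge P e A) k univ *ᵥ f) ⟨x, μ⟩‖ ≤
          P.spacing k * (c₀ * ((((⌊(((P.L : ℝ) ^ k) - 1 + R₀) / sg⌋₊ : ℝ) + 3) ^ (d + 1)) *
                (1 + (P.L : ℝ) ^ k * ((R₀ - R₁)⁻¹ + (sg : ℝ)⁻¹)) *
                Real.exp (-(1 / (8 * (L : ℝ) ^ s) * (((P.L : ℝ) ^ k)⁻¹ * (2 * R - 1)))) +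
              (1 + (P.L : ℝ) ^ k * (R₀ - R₁)⁻¹) * Real.exp (-(1 / (8 * (L : ℝ) ^ s) / 2 * (((P.L : ℝ) ^ k)⁻¹ * (R₁ - 1))))) *
            Real.exp (-(1 / (8 * (L : ℝ) ^ s) / 2 * (((P.L : ℝ) ^ k)⁻¹ * D))) * F) := by
  obtain ⟨C, hC0, hC1, -⟩ := exists_abs_deriv_and_deriv_deriv_smoothTransition_le
  obtain ⟨s₀, H0⟩ := deriv231_regular_of_lipschitz d L hL ha e creg β hcreg hβ hC0
  refine ⟨s₀, fun s hs => ?_⟩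
  obtain ⟨c₀, e₁, hc₀, he₁, H⟩ := H0 s hs
  refine ⟨c₀, e₁, hc₀, he₁, ?_⟩
  intro P hPd hPL k hk1 hkK hks hsize A ec hec hece hreg c M0 hfit0 hN0 sg W hsg R R₀ R₁ hR hR₁ hR10 hW hgap x μ hx hdeep hxe hdeepe
    f F D hF hD hsupp
  exact H P hPd hPL k hk1 hkK hks hsize A ec hec hece hreg c M0 hfit0 hN0 sg W hsg R R₀ R₁ hR hR₁ hR10 hW hgap (zetaPi R₁ R₀ 0)
    (abs_zetaPi_zero_le_one R₁ R₀) (zetaPi_zero_eq_zero_of_le hR10) (zetaPi_zero_eq_one_of_le hR10) (abs_zetaPi_zero_shift_sub_le hC1 hR10)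
    x μ hx hdeep hxe hdeepe f F D hF hD hsupp

end ZetaPiMember

end

end Literature.MathematicalPhysics.QuantumFieldTheory.BalabanImbrieJaffe1984to88.BIJ88LocDerivHolder231RegularTorus
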